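import Mathlib
import Summits.CriticalPhenomena.Ising3DConformalLimit.Theses.ArmDressing

/-!
# Continuum translation invariance of ball-connection scaling limits from lattice translation
# invariance

Support file for crux `BallConnectivityMoebius` (stmt-CriticalPhenomena-16131) of route
`ArmDressing` (sub-problem `Ising3DConformalLimit`), line `registered`: it proves the stub
`stub_translationInvariance` (stub 2b of the skeleton
`Cruxes/BallConnectivityMoebius/Lines/birth.lean`), with the crux's `let`-vocabulary verbatim.

Statement.  Let `Pr m K R` be the thermodynamic-limit critical FK-Ising probability that the
open-path connection relation among the lattice probe sets `K i ⊆ ℤ³` lies in `R`, let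
`mesh δ z = δ z ∈ ℝ³`, `disc δ A = {x ∈ ℤ³ | δ x ∈ A}` and let `gball (c, r)` be the generalised
ball (the closed ball of radius `r` if `r > 0`, the closed exterior of the open ball of radius
`-r` otherwise).  IF `Pr` is invariant under lattice translations of finite / co-finite probe
families (stub 2a, a hypothesis here), THEN every family `lam m R` that is continuous on
`{∀ i, rᵢ ≠ 0}` and is the full-filter `δ → 0⁺` limit of `δ ↦ Pr m (disc δ ∘ gball ∘ p) R` there
is invariant under every translation `u ∈ ℝ³` of the centres.

Proof (pure limit bookkeeping; all the probability sits in the hypothesis).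
1. Exact lattice identity (`tr_disc_gball_translate`): with `δ' = δ/(n+1)`,
   `disc δ' (gball (c + mesh δ z, r)) = {x | x - (n+1) z ∈ disc δ' (gball (c, r))}`.
2. For `δ' > 0` the discretised closed ball is finite and the discretised closed exterior is
   co-finite (`tr_disc_gball_finite_or`), so the hypothesis applies: along `δ/(n+1) → 0⁺` the
   numbers `lam (p + mesh δ z)` and `lam p` are limits of the same sequence, hence equal
   (`tr_lam_translate_mesh`, uniqueness of limits).
3. `mesh (1/(k+1)) ⌊(k+1) u⌋ → u` (`tr_tendsto_mesh_floor`) and `lam m R` is continuous at `p + u`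
   within `{∀ i, rᵢ ≠ 0}`; the sequence `lam (p + v_k) = lam p` is constant, so `lam (p + u) = lam p`
   (`tr_translation_of_latticeTranslation`, stated for an arbitrary functional `P` in place of
   `Pr` and for any `mesh`, `disc`, `gball` satisfying the `let`-definitions, discharged by `rfl`).
Only Mathlib is used; no named facts; no definitions are introduced.
-/

namespace Summit.CriticalPhenomena.Ising3DConformalLimit.ArmDressingBallConnectivityMoebius

open Filter Topology Literature.Probability.LatticeModels

/-! ### The crux's `let`-vocabulary as hypotheses

All lemmas below are stated for arbitrary functions `mesh`, `disc`, `gball` satisfying the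
defining equations of the crux's `let`-bound `mesh δ z = δ z`, `disc δ A = {x | mesh δ x ∈ A}` and
`gball (c, r)` (closed ball / closed exterior); in the stub they are discharged by `rfl`. -/

variable {mesh : ℝ → Site 3 → EuclideanSpace ℝ (Fin 3)}
  {disc : ℝ → Set (EuclideanSpace ℝ (Fin 3)) → Set (Site 3)}
  {gball : EuclideanSpace ℝ (Fin 3) × ℝ → Set (EuclideanSpace ℝ (Fin 3))}

/-- `mesh δ` is additive: `δ (x - y) = δ x - δ y`. [folklore] -/
theorem tr_mesh_sub (hmesh : ∀ δ z, mesh δ z = WithLp.toLp 2 fun i : Fin 3 => δ * (z i : ℝ))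
    (δ : ℝ) (x y : Site 3) : mesh δ (x - y) = mesh δ x - mesh δ y := by
  simp only [hmesh]
  ext i
  simp only [PiLp.sub_apply, Pi.sub_apply, Int.cast_sub, mul_sub]

/-- Change of mesh along the sequence `δ/(n+1)`: `(δ/(n+1)) ((n+1) z) = δ z`. [folklore] -/
theorem tr_mesh_div_succ (hmesh : ∀ δ z, mesh δ z = WithLp.toLp 2 fun i : Fin 3 => δ * (z i : ℝ))
    (δ : ℝ) (n : ℕ) (z : Site 3) :
    mesh (δ / ((n : ℝ) + 1)) (fun i => ((n : ℤ) + 1) * z i) = mesh δ z := by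
  have hn : (n : ℝ) + 1 ≠ 0 := (Nat.cast_add_one_pos n).ne'
  simp only [hmesh]
  ext i
  push_cast
  rw [← mul_assoc, div_mul_cancel₀ δ hn]

/-- Translating the data translates the generalised ball:
`y ∈ gball (c + w, r) ↔ y - w ∈ gball (c, r)` (both signs of `r`). [folklore] -/
theorem tr_mem_gball_add_iff
    (hgball : ∀ q, gball q = if 0 < q.2 then Metric.closedBall q.1 q.2 else (Metric.ball q.1 (-q.2))ᶜ)
    (c w y : EuclideanSpace ℝ (Fin 3)) (r : ℝ) :
    y ∈ gball (c + w, r) ↔ y - w ∈ gball (c, r) := by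
  by_cases h : 0 < r
  · simp only [hgball, if_pos h, Metric.mem_closedBall, dist_sub_eq_dist_add_left]
  · simp only [hgball, if_neg h, Set.mem_compl_iff, Metric.mem_ball, dist_sub_eq_dist_add_left]

/-- THE EXACT LATTICE IDENTITY behind translation invariance: at mesh `δ/(n+1)` the discretisation
of the generalised ball translated by the lattice vector `mesh δ z` is the lattice translate by
`(n+1) z` of the discretisation of the original ball. [folklore] -/
theorem tr_disc_gball_translate
    (hmesh : ∀ δ z, mesh δ z = WithLp.toLp 2 fun i : Fin 3 => δ * (z i : ℝ))
    (hdisc : ∀ δ A, disc δ A = {x | mesh δ x ∈ A})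
    (hgball : ∀ q, gball q = if 0 < q.2 then Metric.closedBall q.1 q.2 else (Metric.ball q.1 (-q.2))ᶜ)
    (δ : ℝ) (n : ℕ) (z : Site 3) (q : EuclideanSpace ℝ (Fin 3) × ℝ) :
    disc (δ / ((n : ℝ) + 1)) (gball (q.1 + mesh δ z, q.2)) =
      {x | x - (fun i => ((n : ℤ) + 1) * z i) ∈ disc (δ / ((n : ℝ) + 1)) (gball q)} := by
  obtain ⟨c, r⟩ := q
  ext x
  simp only [hdisc, Set.mem_setOf_eq]
  rw [tr_mem_gball_add_iff hgball, tr_mesh_sub hmesh, tr_mesh_div_succ hmesh]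

/-- For `δ > 0` the discretisation of a closed ball is a finite subset of `ℤ³`: it lies in the
coordinate box `∏ᵢ [-⌈(r + |cᵢ|)/δ⌉, ⌈(r + |cᵢ|)/δ⌉]`. [folklore] -/
theorem tr_disc_closedBall_finite
    (hmesh : ∀ δ z, mesh δ z = WithLp.toLp 2 fun i : Fin 3 => δ * (z i : ℝ))
    (hdisc : ∀ δ A, disc δ A = {x | mesh δ x ∈ A})
    {δ : ℝ} (hδ : 0 < δ) (c : EuclideanSpace ℝ (Fin 3)) (r : ℝ) :
    (disc δ (Metric.closedBall c r)).Finite := by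
  refine (Set.Finite.pi' fun i : Fin 3 =>
    Set.finite_Icc (-⌈(r + |c i|) / δ⌉) ⌈(r + |c i|) / δ⌉).subset ?_
  intro x hx
  rw [hdisc] at hx
  simp only [Set.mem_setOf_eq]
  intro i
  have hx' : dist (mesh δ x) c ≤ r := hx
  have h1 : |δ * (x i : ℝ) - c i| ≤ r := by
    have h := PiLp.dist_apply_le (mesh δ x) c i
    have hi : (mesh δ x) i = δ * (x i : ℝ) := by simp [hmesh]
    rw [hi, Real.dist_eq] at h
    exact h.trans hx'
  have h2 : |(x i : ℝ)| ≤ (r + |c i|) / δ := by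
    rw [le_div_iff₀ hδ]
    have h3 : |δ * (x i : ℝ)| ≤ r + |c i| := by
      have h4 := abs_sub_abs_le_abs_sub (δ * (x i : ℝ)) (c i)
      linarith
    rwa [abs_mul, abs_of_pos hδ, mul_comm] at h3
  have h5 : |(x i : ℝ)| ≤ ⌈(r + |c i|) / δ⌉ := h2.trans (Int.le_ceil _)
  rw [Set.mem_Icc, ← abs_le]
  exact_mod_cast h5

/-- Side condition of the lattice-translation hypothesis: for `δ > 0` the discretised generalised
ball is finite (closed ball) or co-finite (closed exterior). [folklore] -/
theorem tr_disc_gball_finite_or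
    (hmesh : ∀ δ z, mesh δ z = WithLp.toLp 2 fun i : Fin 3 => δ * (z i : ℝ))
    (hdisc : ∀ δ A, disc δ A = {x | mesh δ x ∈ A})
    (hgball : ∀ q, gball q = if 0 < q.2 then Metric.closedBall q.1 q.2 else (Metric.ball q.1 (-q.2))ᶜ)
    {δ : ℝ} (hδ : 0 < δ) (q : EuclideanSpace ℝ (Fin 3) × ℝ) :
    (disc δ (gball q)).Finite ∨ (disc δ (gball q))ᶜ.Finite := by
  by_cases h : 0 < q.2
  · left
    rw [hgball, if_pos h]
    exact tr_disc_closedBall_finite hmesh hdisc hδ q.1 q.2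
  · right
    rw [hgball, if_neg h]
    refine (tr_disc_closedBall_finite hmesh hdisc hδ q.1 (-q.2)).subset ?_
    intro x hx
    rw [Set.mem_compl_iff, hdisc] at hx
    rw [hdisc]
    have hx' : ¬ (mesh δ x ∉ Metric.ball q.1 (-q.2)) := hx
    show mesh δ x ∈ Metric.closedBall q.1 (-q.2)
    exact Metric.ball_subset_closedBall (not_not.1 hx')

/-- `δ/(n+1) → 0⁺` as `n → ∞` (`δ > 0`). [folklore] -/
theorem tr_tendsto_div_succ {δ : ℝ} (hδ : 0 < δ) :
    Tendsto (fun n : ℕ => δ / ((n : ℝ) + 1)) atTop (𝓝[>] 0) := by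
  refine tendsto_nhdsWithin_iff.2
    ⟨?_, Eventually.of_forall fun n => div_pos hδ (Nat.cast_add_one_pos n)⟩
  have h := (tendsto_one_div_add_atTop_nhds_zero_nat (𝕜 := ℝ)).const_mul δ
  rw [mul_zero] at h
  exact h.congr fun n => mul_one_div δ ((n : ℝ) + 1)

/-- STEP 1 — translation by a lattice vector at a fixed mesh.  If `P` (for the crux:
`K ↦ Pr m K R`) is invariant under lattice translations of finite / co-finite probe families and
`lam` is the full-filter `δ → 0⁺` limit of `P` on discretised generalised balls, then
`lam (p + mesh δ z) = lam p` for every `δ > 0` and `z ∈ ℤ³`: along `δ/(n+1) → 0⁺` the two sides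
are limits of the same sequence (`tr_disc_gball_translate` and the hypothesis), and limits are
unique. [folklore] -/
theorem tr_lam_translate_mesh
    (hmesh : ∀ δ z, mesh δ z = WithLp.toLp 2 fun i : Fin 3 => δ * (z i : ℝ))
    (hdisc : ∀ δ A, disc δ A = {x | mesh δ x ∈ A})
    (hgball : ∀ q, gball q = if 0 < q.2 then Metric.closedBall q.1 q.2 else (Metric.ball q.1 (-q.2))ᶜ)
    {m : ℕ} (P : (Fin m → Set (Site 3)) → ℝ)
    (hT : ∀ (K : Fin m → Set (Site 3)) (z : Site 3), (∀ i, (K i).Finite ∨ (K i)ᶜ.Finite) →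
      P (fun i => {x | x - z ∈ K i}) = P K)
    (lam : (Fin m → EuclideanSpace ℝ (Fin 3) × ℝ) → ℝ)
    (hlim : ∀ p : Fin m → EuclideanSpace ℝ (Fin 3) × ℝ, (∀ i, (p i).2 ≠ 0) →
      Tendsto (fun δ => P (fun i => disc δ (gball (p i)))) (𝓝[>] 0) (𝓝 (lam p)))
    (p : Fin m → EuclideanSpace ℝ (Fin 3) × ℝ) (hp : ∀ i, (p i).2 ≠ 0) {δ : ℝ} (hδ : 0 < δ)
    (z : Site 3) :
    lam (fun i => ((p i).1 + mesh δ z, (p i).2)) = lam p := by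
  have h1 : Tendsto (fun n : ℕ => P (fun i => disc (δ / ((n : ℝ) + 1))
      (gball ((p i).1 + mesh δ z, (p i).2)))) atTop
      (𝓝 (lam (fun i => ((p i).1 + mesh δ z, (p i).2)))) :=
    (hlim (fun i => ((p i).1 + mesh δ z, (p i).2)) hp).comp (tr_tendsto_div_succ hδ)
  have h2 : Tendsto (fun n : ℕ => P (fun i => disc (δ / ((n : ℝ) + 1)) (gball (p i))))
      atTop (𝓝 (lam p)) :=
    (hlim p hp).comp (tr_tendsto_div_succ hδ)
  have h3 : ∀ n : ℕ, P (fun i => disc (δ / ((n : ℝ) + 1))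
      (gball ((p i).1 + mesh δ z, (p i).2))) =
      P (fun i => disc (δ / ((n : ℝ) + 1)) (gball (p i))) := fun n =>
    (congrArg P (funext fun i => tr_disc_gball_translate hmesh hdisc hgball δ n z (p i))).trans
      (hT (fun i => disc (δ / ((n : ℝ) + 1)) (gball (p i))) (fun i => ((n : ℤ) + 1) * z i)
        fun i => tr_disc_gball_finite_or hmesh hdisc hgball (div_pos hδ (Nat.cast_add_one_pos n))
          (p i))
  exact tendsto_nhds_unique (h1.congr h3) h2

/-- Lattice approximation of a real number at mesh `1/(k+1)`: `(1/(k+1)) ⌊(k+1) t⌋ → t`.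
[folklore] -/
theorem tr_tendsto_floor_div (t : ℝ) :
    Tendsto (fun k : ℕ => 1 / ((k : ℝ) + 1) * (⌊((k : ℝ) + 1) * t⌋ : ℝ)) atTop (𝓝 t) := by
  have hpos : ∀ k : ℕ, (0 : ℝ) < (k : ℝ) + 1 := fun k => Nat.cast_add_one_pos k
  have hlow : Tendsto (fun k : ℕ => t - 1 / ((k : ℝ) + 1)) atTop (𝓝 t) := by
    have h := (tendsto_one_div_add_atTop_nhds_zero_nat (𝕜 := ℝ)).const_sub t
    rwa [sub_zero] at h
  refine tendsto_of_tendsto_of_tendsto_of_le_of_le hlow tendsto_const_nhds (fun k => ?_) fun k => ?_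
  · show t - 1 / ((k : ℝ) + 1) ≤ 1 / ((k : ℝ) + 1) * (⌊((k : ℝ) + 1) * t⌋ : ℝ)
    rw [one_div_mul_eq_div, le_div_iff₀ (hpos k), sub_mul, one_div_mul_cancel (hpos k).ne']
    have h := Int.lt_floor_add_one (((k : ℝ) + 1) * t)
    have hc : ((k : ℝ) + 1) * t = t * ((k : ℝ) + 1) := mul_comm _ _
    linarith
  · show 1 / ((k : ℝ) + 1) * (⌊((k : ℝ) + 1) * t⌋ : ℝ) ≤ t
    rw [one_div_mul_eq_div, div_le_iff₀ (hpos k)]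
    exact (Int.floor_le _).trans_eq (mul_comm _ _)

/-- Every `u ∈ ℝ³` is a limit of lattice vectors at meshes `1/(k+1)`:
`mesh (1/(k+1)) ⌊(k+1) u⌋ → u` (coordinatewise `tr_tendsto_floor_div`). [folklore] -/
theorem tr_tendsto_mesh_floor
    (hmesh : ∀ δ z, mesh δ z = WithLp.toLp 2 fun i : Fin 3 => δ * (z i : ℝ))
    (u : EuclideanSpace ℝ (Fin 3)) :
    Tendsto (fun k : ℕ => mesh (1 / ((k : ℝ) + 1)) (fun i => ⌊((k : ℝ) + 1) * u i⌋)) atTop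
      (𝓝 u) := by
  have h : Tendsto (fun k : ℕ => fun i : Fin 3 =>
      1 / ((k : ℝ) + 1) * ((⌊((k : ℝ) + 1) * u i⌋ : ℤ) : ℝ)) atTop (𝓝 (WithLp.ofLp u)) :=
    tendsto_pi_nhds.2 fun i => tr_tendsto_floor_div (u i)
  have h2 := ((PiLp.continuous_toLp 2 (fun _ : Fin 3 => ℝ)).tendsto (WithLp.ofLp u)).comp h
  rw [WithLp.toLp_ofLp] at h2
  simp only [hmesh]
  exact h2

/-- STEP 2 — continuum translation invariance, for an arbitrary functional `P` in place of the
crux's `Pr`: lattice translation invariance of `P` on finite / co-finite families, continuity of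
the full-filter limits `lam m R` on `{∀ i, rᵢ ≠ 0}` and convergence there imply
`lam m R (p + u) = lam m R p` for every `u ∈ ℝ³` — STEP 1 on the lattice vectors
`mesh (1/(k+1)) ⌊(k+1) u⌋ → u`, then continuity within `{∀ i, rᵢ ≠ 0}` and uniqueness of the limit
of the constant sequence. [folklore] -/
theorem tr_translation_of_latticeTranslation
    (mesh : ℝ → Site 3 → EuclideanSpace ℝ (Fin 3))
    (disc : ℝ → Set (EuclideanSpace ℝ (Fin 3)) → Set (Site 3))
    (gball : EuclideanSpace ℝ (Fin 3) × ℝ → Set (EuclideanSpace ℝ (Fin 3)))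
    (hmesh : ∀ δ z, mesh δ z = WithLp.toLp 2 fun i : Fin 3 => δ * (z i : ℝ))
    (hdisc : ∀ δ A, disc δ A = {x | mesh δ x ∈ A})
    (hgball : ∀ q, gball q = if 0 < q.2 then Metric.closedBall q.1 q.2 else (Metric.ball q.1 (-q.2))ᶜ)
    (P : (m : ℕ) → (Fin m → Set (Site 3)) → Set (Fin m → Fin m → Prop) → ℝ)
    (hT : ∀ (m : ℕ) (R : Set (Fin m → Fin m → Prop)) (K : Fin m → Set (Site 3)) (z : Site 3),
      (∀ i, (K i).Finite ∨ (K i)ᶜ.Finite) → P m (fun i => {x | x - z ∈ K i}) R = P m K R)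
    (lam : (m : ℕ) → Set (Fin m → Fin m → Prop) → (Fin m → EuclideanSpace ℝ (Fin 3) × ℝ) → ℝ)
    (hcont : ∀ (m : ℕ) (R : Set (Fin m → Fin m → Prop)),
      ContinuousOn (lam m R) {p | ∀ i, (p i).2 ≠ 0})
    (hlim : ∀ (m : ℕ) (R : Set (Fin m → Fin m → Prop)) (p : Fin m → EuclideanSpace ℝ (Fin 3) × ℝ),
      (∀ i, (p i).2 ≠ 0) →
      Tendsto (fun δ => P m (fun i => disc δ (gball (p i))) R) (𝓝[>] 0) (𝓝 (lam m R p)))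
    (m : ℕ) (R : Set (Fin m → Fin m → Prop)) (p : Fin m → EuclideanSpace ℝ (Fin 3) × ℝ)
    (u : EuclideanSpace ℝ (Fin 3)) (hp : ∀ i, (p i).2 ≠ 0) :
    lam m R (fun i => ((p i).1 + u, (p i).2)) = lam m R p := by
  -- lattice vectors `v k → u` along which `lam m R` does not move (STEP 1)
  obtain ⟨v, hv, hconst⟩ : ∃ v : ℕ → EuclideanSpace ℝ (Fin 3), Tendsto v atTop (𝓝 u) ∧
      ∀ k, lam m R (fun i => ((p i).1 + v k, (p i).2)) = lam m R p :=
    ⟨fun k => mesh (1 / ((k : ℝ) + 1)) (fun i => ⌊((k : ℝ) + 1) * u i⌋),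
      tr_tendsto_mesh_floor hmesh u,
      fun k => tr_lam_translate_mesh hmesh hdisc hgball (fun K => P m K R)
        (fun K z hK => hT m R K z hK) (lam m R) (hlim m R) p hp
        (one_div_pos.2 (Nat.cast_add_one_pos k)) (fun i => ⌊((k : ℝ) + 1) * u i⌋)⟩
  -- the translated configurations converge, inside the nonzero-radius set
  have hPk : Tendsto (fun k : ℕ => fun i => ((p i).1 + v k, (p i).2)) atTop
      (𝓝 (fun i => ((p i).1 + u, (p i).2))) :=
    tendsto_pi_nhds.2 fun i => (tendsto_const_nhds.add hv).prodMk_nhds tendsto_const_nhds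
  have hPkU : Tendsto (fun k : ℕ => fun i => ((p i).1 + v k, (p i).2)) atTop
      (𝓝[{q | ∀ i, (q i).2 ≠ 0}] (fun i => ((p i).1 + u, (p i).2))) :=
    tendsto_nhdsWithin_iff.2 ⟨hPk, Eventually.of_forall fun _ => hp⟩
  -- continuity of `lam m R` within the nonzero-radius set at `p + u`
  have hlam : Tendsto (fun k : ℕ => lam m R (fun i => ((p i).1 + v k, (p i).2))) atTop
      (𝓝 (lam m R (fun i => ((p i).1 + u, (p i).2)))) :=
    (hcont m R (fun i => ((p i).1 + u, (p i).2)) hp).tendsto.comp hPkU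
  exact tendsto_nhds_unique (hlam.congr hconst) tendsto_const_nhds

set_option linter.unusedVariables false in
/-- **Stub `stub_translationInvariance`** (stub 2b of line `registered`, crux
`BallConnectivityMoebius`, exact registered signature): lattice translation invariance of the
thermodynamic-limit connection laws `Pr` on finite / co-finite probe families implies CONTINUUM
TRANSLATION INVARIANCE of every continuous full-filter scaling-limit family `lam m R` of the
ball-connection probabilities.  The crux's `let`-vocabulary (`Pr`, `mesh`, `disc`, `gball`) is
introduced and the statement is `tr_translation_of_latticeTranslation` with `P := Pr` and the
`let`-bound `mesh`, `disc`, `gball`, whose defining equations hold by `rfl`.  (The registered signature's `let ginv` is not referenced by this stub's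
statement, whence the `unusedVariables` linter is switched off for this one declaration.)
[folklore] -/
theorem stub_translationInvariance : open Literature.Probability.LatticeModels Literature.Probability.Percolation Literature.Barriers.CriticalPhenomena Filter Topology in let E3 := EuclideanSpace ℝ (Fin 3); let μ : (L : ℕ) → MeasureTheory.Measure (BondConfig (BoxV 3 L)) := fun L => rcMeasure (boxGraph 3 L) (fkIsingParam (criticalBeta 3)) 2 (boxBoundary 3 L); let PrL : (m : ℕ) → (Fin m → Set (Site 3)) → Set (Fin m → Fin m → Prop) → ℕ → ℝ := fun _ K R L => (μ L).real {ω | (fun i j => ∃ x y : BoxV 3 L, x.1 ∈ K i ∧ y.1 ∈ K j ∧ (openGraph ω).Reachable x y) ∈ R}; let Pr : (m : ℕ) → (Fin m → Set (Site 3)) → Set (Fin m → Fin m → Prop) → ℝ := fun m K R => limUnder atTop (PrL m K R); let mesh : ℝ → Site 3 → E3 := fun δ z => WithLp.toLp 2 fun i : Fin 3 => δ * (z i : ℝ); let disc : ℝ → Set E3 → Set (Site 3) := fun δ A => {x | mesh δ x ∈ A}; let gball : E3 × ℝ → Set E3 := fun p => if 0 < p.2 then Metric.closedBall p.1 p.2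 else (Metric.ball p.1 (-p.2))ᶜ; let ginv : E3 × ℝ → E3 × ℝ := fun p => ((‖p.1‖ ^ 2 - p.2 ^ 2)⁻¹ • p.1, p.2 / (‖p.1‖ ^ 2 - p.2 ^ 2)); (∀ (m : ℕ) (R : Set (Fin m → Fin m → Prop)) (K : Fin m → Set (Site 3)) (z : Site 3), (∀ i, (K i).Finite ∨ (K i)ᶜ.Finite) → Pr m (fun i => {x | x - z ∈ K i}) R = Pr m K R) → ∀ lam : (m : ℕ) → Set (Fin m → Fin m → Prop) → (Fin m → E3 × ℝ) → ℝ, (∀ (m : ℕ) (R : Set (Fin m → Fin m → Prop)), ContinuousOn (lam m R) {p | ∀ i, (p i).2 ≠ 0}) → (∀ (m : ℕ) (R : Set (Fin m → Fin m → Prop)) (p : Fin m → E3 × ℝ), (∀ i, (p i).2 ≠ 0) → Tendsto (fun δ => Pr m (fun i => disc δ (gball (p i))) R) (𝓝[>] 0) (𝓝 (lam m R p))) → (∀ (m : ℕ) (R : Set (Fin m → Fin m → Prop)) (p : Fin m → E3 × ℝ) (u : E3), (∀ i, (p i).2 ≠ 0) → lam m R (fun i => ((p i).1 + u, (p i).2))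 = lam m R p) := by
  intro E3 μ PrL Pr mesh disc gball ginv hT lam hcont hlim
  exact tr_translation_of_latticeTranslation mesh disc gball (fun _ _ => rfl) (fun _ _ => rfl)
    (fun _ => rfl) Pr hT lam hcont hlim

end Summit.CriticalPhenomena.Ising3DConformalLimit.ArmDressingBallConnectivityMoebius
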